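import Literature.MathematicalPhysics.QuantumFieldTheory.Balaban1983to89.B8Prop6OfThm4Rec

/-!
# `Balaban1983to89.B8BlockConstantLiftStabilityRec` — [Balaban1985RegularSpaces] (1.33)–(1.34), (1.66) (Theorem 4's input conditions for the pair `1, U′`) UNDER A GAUGE
# TRANSFORMATION CONSTANT ON THE BLOCK TOWERS UNDER THE CELLS, record structure: the RADIAL axial surface `Ax_k(ℭ, 1)` (`InAxOneZ`) is PRESERVED, `𝔄_k` (`InAk`) is invariant,
# and (1.66) (`Cond166CubeZ`) degrades only by the oscillation of the transformation between adjacent blocks — item (B′-2) of the plan's road (B′) for director-ym №310's branch (ii)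

statement-level skeleton of published theorems with citation tags; proofs where landed; nothing here is a claim about the Yang–Mills mass gap

CITATION HEADER (lean-in-tree rule).  Cell `pub-ymgap` (HUMAN RULING D-0062), «N05-REC» road; director-ym №310 branch (ii); plan g93 ■ re-presentation 2026-08-29T20:37Z: ROAD-INDEPENDENT
GO for (B′-1) (`B8BlockConstantLiftRec`, the block-constant transformation `g_c` and its exact (1.29)-data) and (B′-2) = THIS FILE: the hypotheses of `B8Prop6OfThm4Rec.Thm4AtOneZ`
(Theorem 4 at background `1`, record tower) survive the pre-composition `U′ ↦ U′^{h}` for `h` constant under the cells.  Pen dag-n05-e g41.  [6] = [Balaban1985RegularSpaces] (1.33)–(1.34)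
p. 82, (1.15) p. 78, (1.19) p. 79, (1.66) p. 87, Thm. 4 p. 88, (1.131)–(1.133) p. 99; [3] = [Balaban1985Averaging] (8), (11) pp. 18–19, (45) p. 24; [15] = [Balaban1985Variational] (148) p. 301;
[I] = [Balaban1987RG1] (0.3) p. 252, (0.6) p. 253.  `--kind proof --supports stmt-QuantumFields-20541` (K0⁷; count-neutral; no definition).
REUSED BY NAME: `BlockAveragingZdCovariance.avgIterZ_gaugeAct_units` (the record average is gauge covariant UNCONDITIONALLY, [I] (0.6)), `B7AvgGaugeCovariance.uLev`,
`B8Eq115GaugeFixing.axialFn_gaugeAct`, `B8Ineq132.inAk_gaugeAct_iff`, `B8Eq119TwistedAxialRec.{InAxOneZ, UnderZ, underZ_one_block}`, `BlockAveragingZd.two_mul_ctrShift_add_one`,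
`B8Prop6OfThm4Rec.{Cond166CubeZ, cond166CubeZ_one_iff}`, `B7Prop1Explicit.{gaugeAct, U1}`.

WHY (memo `SCOPE-IIB.md` §§3–4).  Theorem 4 as typed fires only for inputs on the RADIAL axial surface `InAxOneZ`; a site-dependent gauge change leaves it, but a transformation `h`
CONSTANT on the fine block tower `Bʲ(x_j)` under every cell `x_j ∈ Λ_j` (`j ≥ 1`) conjugates every radial transporter `Ūⁿ(Γ_{L·z, x})` inside that tower by the SAME constant
(`\overline{U^h}ⁿ = (Ūⁿ)^{h_n}`, `h_n(w) = h(Lⁿ·w)`, and both `Lⁿ·(L·z)` and `Lⁿ·(L·z + offZ r)` lie under `x_j`), so axiality is kept; `𝔄_k` is gauge invariant; and on a coarse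
bond `⟨x, x + e_ν⟩` of `□_j` the average `Ū′ʲ` is conjugated by `h_j(x)`, `h_j(x + e_ν)`, whence `|Ū′ʲ − 1| < α₁ + osc(h)`.  With (B′-1)'s `g_c` this is the input half of road
(B′): `Thm4AtOneZ` applies to `U′^{g_c⁻¹}` with `α₁ ↦ α₁ + osc(g_c)`.
WHAT IS PROVED (sorry-free).  §1 `underZ_pow_smul` (the centre `Lᵐ·w` of the tower under `w`), ★ `underZ_add` (towers compose: depth `a` under `x`, depth `b` under that ⇒ depth
`a + b` under `x`); §2 ★★ `inAxOneZ_gaugeAct_of_blockConstant` — `InAxOneZ L k Λ W → InAxOneZ L k Λ (W^{h})` for `h` constant under every cell of level `≥ 1`; §3 ★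
`inAk_gaugeAct_of_U1` (restated invariance) and ★★ `cond166CubeZ_one_gaugeAct_of_osc` — `Cond166CubeZ … 1 U′ α₁` and `‖h_j(x) − h_j(x+e_ν)‖ ≤ τ` on the boxes ⇒
`Cond166CubeZ … 1 (U′^{h}) (α₁ + τ)` (`h` `U1`-valued).
HONEST SCOPE.  Gauge-covariance bookkeeping ([3] (8), (11), (45)); NO estimate of Bałaban's; the `prop6_of_thm4` twin with the pre-composed input (B′-3), the crown re-assembly (B′-4)
and the second-order data defect (B′-5) are NOT here and wait for the director's ruling on (B′) ∣ (B) ∣ ρ2; `HThm4Rec*` CONDITIONAL; N05 DISCHARGED OF RECORD since R467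
(count-neutral record-level work), N07 NOT discharged; counts unmoved (typed 28∕28 · discharged 8∕28); one finite 𝕋⁴ programme at fixed ε, `G = SU(2)` of record — nothing
continuum ∕ ℝ⁴ ∕ OS ∕ mass gap ∕ Clay.  No `def`, no `instance`, no `notation`, no `sorry`.
-/

set_option autoImplicit false

noncomputable section

namespace Literature.MathematicalPhysics.QuantumFieldTheory.Balaban1983to89.B8BlockConstantLiftStabilityRec

open B7Prop1Explicit hiding Site
open B7Prop1Explicit renaming Site → SiteZ
open B7AvgGaugeCovariance (uLev uLev_apply)
open BlockAveragingZd (offZ avgIterZ ctrShift two_mul_ctrShift_add_one)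
open BlockAveragingZdCovariance (avgIterZ_gaugeAct_units)
open B8Eq115GaugeFixing (axialFn_gaugeAct)
open B8Ineq132 (InAk inAk_gaugeAct_iff)
open B8Eq119TwistedAxialRec (InAxOneZ UnderZ underZ_one_block)
open B8Eq131CubesRec (sqLoZ sqHiZ)
open B8Prop6OfThm4Rec (Cond166CubeZ cond166CubeZ_one_iff)

variable {d : ℕ}

/-! ## §1  The centred block tower: centres and composition of depths -/

/-- The fine centre `Lᵐ·w` of the depth-`m` tower under `w` lies under `w`. [cite: Balaban1987RG1, (0.3) p.252; Balaban1985RegularSpaces, (1.19) p.79 (bookkeeping)] -/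
theorem underZ_pow_smul (L m : ℕ) (w : SiteZ d) : UnderZ L m w (((L : ℤ) ^ m) • w) := by
  intro i
  have h0 : (0 : ℤ) ≤ (ctrShift L m : ℤ) := by positivity
  simp only [Pi.smul_apply, smul_eq_mul, sub_self]
  exact ⟨by linarith, h0⟩

/-- ★ **Towers compose** (odd `L`): `y ∈ Bᵃ(x)` and `z ∈ Bᵇ(y)` ⇒ `z ∈ B^{a+b}(x)` — the centred shifts satisfy `c_{a+b} = Lᵇ·c_a + c_b`.
[cite: Balaban1985RegularSpaces, p.79 («x_n ∈ B(x_{n+1}), n = 0, 1, …, j − 1»); Balaban1987RG1, (0.3) p.252] -/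
theorem underZ_add {L : ℕ} (hL : Odd L) {a b : ℕ} {x y z : SiteZ d} (hy : UnderZ L a x y) (hz : UnderZ L b y z) :
    UnderZ L (a + b) x z := by
  intro i
  obtain ⟨h1, h2⟩ := hy i
  obtain ⟨h3, h4⟩ := hz i
  have hLb : (0 : ℤ) ≤ (L : ℤ) ^ b := by positivity
  have hca : 2 * (ctrShift L a : ℤ) + 1 = (L : ℤ) ^ a := by exact_mod_cast two_mul_ctrShift_add_one hL a
  have hcb : 2 * (ctrShift L b : ℤ) + 1 = (L : ℤ) ^ b := by exact_mod_cast two_mul_ctrShift_add_one hL b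
  have hcab : 2 * (ctrShift L (a + b) : ℤ) + 1 = (L : ℤ) ^ (a + b) := by exact_mod_cast two_mul_ctrShift_add_one hL (a + b)
  have key : (ctrShift L (a + b) : ℤ) = (L : ℤ) ^ b * ctrShift L a + ctrShift L b := by
    have : (L : ℤ) ^ (a + b) = (L : ℤ) ^ b * (L : ℤ) ^ a := by rw [pow_add, mul_comm]
    nlinarith
  have h5 := mul_le_mul_of_nonneg_left h1 hLb
  have h6 := mul_le_mul_of_nonneg_left h2 hLb
  have hexp : z i - (L : ℤ) ^ (a + b) * x i = (z i - (L : ℤ) ^ b * y i) + (L : ℤ) ^ b * (y i - (L : ℤ) ^ a * x i) := by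
    rw [pow_add]; ring
  rw [key, hexp]
  constructor <;> nlinarith

/-! ## §2  The radial axial surface `Ax_k(ℭ, 1)` is preserved by transformations constant under the cells -/

section Axial

variable {𝔸 : Type*} [NormedRing 𝔸] [NormedAlgebra ℂ 𝔸] [CompleteSpace 𝔸]

/-- ★★ **`Ax_k(ℭ, 1)` IS PRESERVED BY A GAUGE TRANSFORMATION CONSTANT ON THE BLOCK TOWER UNDER EVERY CELL** ([6] (1.15)∕(1.19) at background `1`, record averages (0.4); odd `L`):
if `h(x) = X(j, x_j)` for every fine `x ∈ Bʲ(x_j)`, `x_j ∈ Λ_j`, `1 ≤ j ≤ k`, then `InAxOneZ L k Λ W → InAxOneZ L k Λ (W^{h})`.  The `n`-fold record average is covariant with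
`h_n(w) = h(Lⁿ·w)` ([I] (0.6), `avgIterZ_gaugeAct_units`); the radial transporter `Ūⁿ(Γ_{L·z, L·z + n_r})` becomes `h_n(L·z)·Ūⁿ(Γ)·h_n(L·z + n_r)⁻¹` (`axialFn_gaugeAct`),
and both fine sites `L^{n+1}·z`, `Lⁿ·(L·z + n_r)` lie under `x_j` (§1), where `h` is the constant `X(j, x_j)`: `X·1·X⁻¹ = 1`.
[cite: Balaban1985RegularSpaces, (1.15) p.78, (1.19) p.79, (1.34) p.82, (1.132) p.99; Balaban1985Averaging, (8) p.18, (11) p.19; Balaban1987RG1, (0.6) p.253] -/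
theorem inAxOneZ_gaugeAct_of_blockConstant {L : ℕ} (hL : Odd L) (k : ℕ) (Λ : ℕ → Set (SiteZ d)) (X : ℕ → SiteZ d → 𝔸ˣ)
    (h : SiteZ d → 𝔸ˣ) (hh : ∀ j, 1 ≤ j → j ≤ k → ∀ xj ∈ Λ j, ∀ x, UnderZ L j xj x → h x = X j xj)
    {W : SiteZ d → Fin d → 𝔸ˣ} (hW : InAxOneZ L k Λ W) : InAxOneZ L k Λ (gaugeAct h W) := by
  intro j hj1 hjk xj hxj n hn z hz r
  rw [avgIterZ_gaugeAct_units L h W n, axialFn_gaugeAct, hW j hj1 hjk xj hxj n hn z hz r, mul_one, uLev_apply, uLev_apply]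
  -- both fine sites lie under `x_j` at depth `j`
  have hdepth : j - (n + 1) + (n + 1) = j := by omega
  have h1 : UnderZ L j xj (((L : ℤ) ^ n) • ((L : ℤ) • z)) := by
    have hz' : UnderZ L (n + 1) z (((L : ℤ) ^ n) • ((L : ℤ) • z)) := by
      have : ((L : ℤ) ^ n) • ((L : ℤ) • z) = ((L : ℤ) ^ (n + 1)) • z := by rw [smul_smul, ← pow_succ]
      rw [this]; exact underZ_pow_smul L (n + 1) z
    have := underZ_add hL hz hz'
    rwa [hdepth] at this
  have h2 : UnderZ L j xj (((L : ℤ) ^ n) • ((L : ℤ) • z + offZ L r)) := by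
    obtain ⟨s, hs⟩ := hL
    have hb : UnderZ L 1 z ((L : ℤ) • z + offZ L r) := underZ_one_block hs z r
    have hc : UnderZ L n ((L : ℤ) • z + offZ L r) (((L : ℤ) ^ n) • ((L : ℤ) • z + offZ L r)) := underZ_pow_smul L n _
    have h12 : UnderZ L (1 + n) z (((L : ℤ) ^ n) • ((L : ℤ) • z + offZ L r)) := underZ_add ⟨s, hs⟩ hb hc
    have := underZ_add ⟨s, hs⟩ hz h12
    rwa [show j - (n + 1) + (1 + n) = j by omega] at this
  rw [hh j hj1 hjk xj hxj _ h1, hh j hj1 hjk xj hxj _ h2, mul_inv_cancel]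

end Axial

/-! ## §3  `𝔄_k` is invariant; (1.66) degrades by the oscillation of `h` between adjacent blocks -/

section Smallness

variable {𝔸 : Type*} [NormedRing 𝔸] [NormOneClass 𝔸] [NormedAlgebra ℂ 𝔸] [CompleteSpace 𝔸]

omit [NormedAlgebra ℂ 𝔸] [CompleteSpace 𝔸] in
/-- `‖a·W·b⁻¹ − 1‖ ≤ ‖W − 1‖ + ‖a − b‖` for `a, b ∈ U1` (unit-ball gauge values): conjugation by nearby group elements moves `W` by their distance. [cite: Balaban1985Averaging, (45) p.24 (bookkeeping)] -/
theorem norm_mul_mul_inv_sub_one_le {a b : 𝔸ˣ} (ha : a ∈ U1 𝔸) (hb : b ∈ U1 𝔸) (W : 𝔸) :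
    ‖(a : 𝔸) * W * ((b⁻¹ : 𝔸ˣ) : 𝔸) - 1‖ ≤ ‖W - 1‖ + ‖(a : 𝔸) - (b : 𝔸)‖ := by
  have hsplit : (a : 𝔸) * W * ((b⁻¹ : 𝔸ˣ) : 𝔸) - 1 =
      (a : 𝔸) * (W - 1) * ((b⁻¹ : 𝔸ˣ) : 𝔸) + ((a : 𝔸) - (b : 𝔸)) * ((b⁻¹ : 𝔸ˣ) : 𝔸) := by
    rw [mul_sub, sub_mul, mul_one, sub_mul, Units.mul_inv]
    abel
  rw [hsplit]
  calc ‖(a : 𝔸) * (W - 1) * ((b⁻¹ : 𝔸ˣ) : 𝔸) + ((a : 𝔸) - (b : 𝔸)) * ((b⁻¹ : 𝔸ˣ) : 𝔸)‖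
      ≤ ‖(a : 𝔸) * (W - 1) * ((b⁻¹ : 𝔸ˣ) : 𝔸)‖ + ‖((a : 𝔸) - (b : 𝔸)) * ((b⁻¹ : 𝔸ˣ) : 𝔸)‖ := norm_add_le _ _
    _ ≤ ‖(a : 𝔸)‖ * ‖W - 1‖ * ‖((b⁻¹ : 𝔸ˣ) : 𝔸)‖ + ‖(a : 𝔸) - (b : 𝔸)‖ * ‖((b⁻¹ : 𝔸ˣ) : 𝔸)‖ :=
        add_le_add ((norm_mul_le _ _).trans (mul_le_mul_of_nonneg_right (norm_mul_le _ _) (norm_nonneg _))) (norm_mul_le _ _)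
    _ ≤ 1 * ‖W - 1‖ * 1 + ‖(a : 𝔸) - (b : 𝔸)‖ * 1 := by
        gcongr
        · exact ha.1
        · exact hb.2
        · exact hb.2
    _ = ‖W - 1‖ + ‖(a : 𝔸) - (b : 𝔸)‖ := by ring

omit [CompleteSpace 𝔸] in
/-- ★ **`𝔄_k` IS GAUGE INVARIANT** (restated from `B8Ineq132.inAk_gaugeAct_iff` for `U1`-valued `h`): plaquette variables are conjugated ([3] (8), (45)).
[cite: Balaban1985RegularSpaces, (1.4) p.77, (1.33)–(1.34) p.82; Balaban1985Averaging, (8) p.18, (45) p.24] -/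
theorem inAk_gaugeAct_of_U1 (L k : ℕ) (η α : ℝ) (Ω : ℕ → Set (SiteZ d)) {h : SiteZ d → 𝔸ˣ} (hh : ∀ x, h x ∈ U1 𝔸)
    {U : SiteZ d → Fin d → 𝔸ˣ} (hU : InAk L k η α Ω U) : InAk L k η α Ω (gaugeAct h U) :=
  (inAk_gaugeAct_iff L k η α Ω hh U).2 hU

/-- ★★ **(1.66) FOR THE PAIR `1, U′^{h}` FROM (1.66) FOR `1, U′`, DEGRADED BY THE OSCILLATION OF `h`** (record cube tower `□_j^{(j)}`): if `|Ū′ʲ(b) − 1| < α₁` on the level-`j` bonds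
`b = ⟨x, x + e_ν⟩` of `□_j` (`Cond166CubeZ … 1 U′ α₁`) and `‖h_j(x) − h_j(x + e_ν)‖ ≤ τ` there (`h_j(w) = h(Lʲ·w)`), then `|\overline{U′^{h}}ʲ(b) − 1| < α₁ + τ`: the average is
`h_j(x)·Ū′ʲ(b)·h_j(x + e_ν)⁻¹` ([I] (0.6)).  For a transformation constant on the block towers under the cells, `τ` = the variation of the cell data between adjacent cells (zero
inside a cell's own tower). [cite: Balaban1985RegularSpaces, (1.66) p.87, (1.133) p.99; Balaban1985Averaging, (11) p.19, (45) p.24; Balaban1987RG1, (0.6) p.253] -/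
theorem cond166CubeZ_one_gaugeAct_of_osc (L k : ℕ) (a : SiteZ d) (M ρ : ℕ) {h : SiteZ d → 𝔸ˣ} (hh : ∀ x, h x ∈ U1 𝔸)
    {U' : SiteZ d → Fin d → 𝔸ˣ} {α₁ τ : ℝ} (h66 : Cond166CubeZ L k a M ρ (1 : SiteZ d → Fin d → 𝔸ˣ) U' α₁)
    (hosc : ∀ j, j ≤ k → ∀ (x : SiteZ d) (ν : Fin d), sqLoZ L a ρ k j ≤ x → x + e ν ≤ sqHiZ L a M ρ k j →
      ‖((uLev L h j x : 𝔸ˣ) : 𝔸) - ((uLev L h j (x + e ν) : 𝔸ˣ) : 𝔸)‖ ≤ τ) :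
    Cond166CubeZ L k a M ρ (1 : SiteZ d → Fin d → 𝔸ˣ) (gaugeAct h U') (α₁ + τ) := by
  rw [cond166CubeZ_one_iff] at h66 ⊢
  intro j hj x ν hlo hhi
  rw [avgIterZ_gaugeAct_units L h U' j]
  show ‖((uLev L h j x * avgIterZ L U' j x ν * (uLev L h j (x + e ν))⁻¹ : 𝔸ˣ) : 𝔸) - 1‖ < α₁ + τ
  rw [Units.val_mul, Units.val_mul]
  have hb := norm_mul_mul_inv_sub_one_le (a := uLev L h j x) (b := uLev L h j (x + e ν))
    (hh (((L : ℤ) ^ j) • x)) (hh (((L : ℤ) ^ j) • (x + e ν))) ((avgIterZ L U' j x ν : 𝔸ˣ) : 𝔸)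
  have h1 := h66 j hj x ν hlo hhi
  have h2 := hosc j hj x ν hlo hhi
  linarith

end Smallness

end Literature.MathematicalPhysics.QuantumFieldTheory.Balaban1983to89.B8BlockConstantLiftStabilityRec
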